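import Summits.HodgeConjecture.CorCM.Census.VoronoiStarReduction
import Summits.HodgeConjecture.CorCM.Census.BlockParityRelations
import Summits.HodgeConjecture.CorCM.Census.CoinvariantFloor

/-!
# Base-block covering, joint form: extend an explicit NEAR family by a far covering KEEPING fibre-independence

COR-CM (cell `pub-hodgecm2`), count-neutral kernel combinatorics by the binder seat b09 (gen 38; lane TWO-ADIC SPLITTING +
NONDEGENERATE REDUCTION, part L), sequel of parts C/E/K (`Census/BaseBlockCovering.lean`, `Census/VoronoiStarReduction.lean`,
`Census/BaseBlockCoveringFrom.lean`: `bpot`, `exists_choice`, `par_cover_self/other`, `blk_out`, the threshold covering), of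
`Census/CoinvariantFloor.lean` (`par2`, `par2_red`, `rad2_le_ker_par2`) and `Census/BlockParityRelations.lean` (`oflipCM_oflipCM_self`) used BY NAME.  Theorems only: no definition, no `decide`, no certificate, no named fact, no `sorry`.
HONEST FRAMING: `HC_CM` is NOT proved, here or anywhere in the tree; nothing here is a period or a headline.

WHY.  The meta-theorem (part D) wants ONE fibre-independent family `S` doing everything; a closing argument supplies an explicit NEAR family
`S₁` (faces at and near the base type, whose corners it knows) and wants the FAR blocks (potential `≥ ρ`) covered generically.  The far covering
of part K is built by choice, so its joint independence with `S₁` cannot be checked by the user — this file proves it ONCE: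

**THEOREM (`exists_joint_cover`).**  Let `ρ ≥ 2` and let `S₁` be a finite fibre-independent family of integer vectors whose block parities VANISH
ON EVERY FAR BLOCK (`bpot ≥ ρ`; automatic for faces at the base type when `ρ ≥ 3`, their corners having potential `≤ 2`).  Then there is a far
covering `S₂ ⊆ gfaceSet` — EXACTLY one face per block of potential `≥ ρ`, disjoint from `S₁`, with the `toward a nearest base change` property
through every type of potential `≥ ρ` modulo any lattice containing its base changes — such that `S₁ ∪ S₂` is FIBRE-INDEPENDENT.
Proof: the block parities factor through the fibre; in a vanishing combination, evaluate at the pivot block of a far member of maximal potential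
with non-zero coefficient: near members vanish there (far block), other far members vanish there (pivot profile, distinct pivots), contradiction;
so the combination lives on `S₁`, where independence is the hypothesis.

## References
* [Pohlmann1968] H. Pohlmann, Algebraic cycles on abelian varieties of complex multiplication type, Ann. of Math. 88 (1968), Thm 1.
-/

namespace Summit.HodgeConjecture.CorCM.Census.BaseBlock

open Finset
open Summit.HodgeConjecture.CorCM.Prior.AllgGroup.RfwfAllgGroup
open Summit.HodgeConjecture.CorCM.Census.BlockParity
open Summit.HodgeConjecture.CorCM.Census.Coinvariant
open Summit.HodgeConjecture.CorCM.Census.TwistGeneration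

noncomputable section

variable {G : Type*} [Group G] [Fintype G] [DecidableEq G] (c : G) (T₀ : CMF G c)

/-- The block parity read through the fibre: `par f B` is a linear function of the fibre image of `f`. [folklore] -/
theorem par_eq_liftQ_mkQ (hc2 : c * c = 1) (f : CMF G c →₀ ℤ) :
    par c f = (rad2 c hc2).liftQ (par2 c) (rad2_le_ker_par2 c hc2) ((rad2 c hc2).mkQ (red c f)) := by
  rw [Submodule.mkQ_apply, Submodule.liftQ_apply, par2_red]

/-- **THE JOINT COVERING.**  See the file header. [folklore] -/
theorem exists_joint_cover (hc2 : c * c = 1) (ρ : ℕ) (hρ : 2 ≤ ρ) (S₁ : Finset (CMF G c →₀ ℤ))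
    (hli₁ : LinearIndepOn (ZMod 2) (fun f : CMF G c →₀ ℤ => (rad2 c hc2).mkQ (red c f)) ↑S₁)
    (hfar₁ : ∀ f ∈ S₁, ∀ B : Block c, ρ ≤ bpot c T₀ B.out → par c f B = 0) :
    ∃ S₂ : Finset (CMF G c →₀ ℤ), (↑S₂ ⊆ gfaceSet G c hc2) ∧
      S₂.card = (univ.filter fun Bk : Block c => ρ ≤ bpot c T₀ Bk.out).card ∧ Disjoint S₁ S₂ ∧
      LinearIndepOn (ZMod 2) (fun f : CMF G c →₀ ℤ => (rad2 c hc2).mkQ (red c f)) ↑(S₁ ∪ S₂) ∧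
      ∀ L : Submodule ℤ (CMF G c →₀ ℤ), Submodule.span ℤ (translates c S₂) ≤ L →
        ∀ Φ : CMF G c, ρ ≤ bpot c T₀ Φ → ∃ Q t t' : G, bpot c T₀ Φ = ddist (rt c Q T₀) Φ ∧
          t ∈ (rt c Q T₀).1 \ Φ.1 ∧ t' ∈ (rt c Q T₀).1 \ Φ.1 ∧ t ≠ t' ∧ gface c hc2 Φ t t' ∈ L := by
  classical
  -- the construction of part K, kept open for the joint independence
  have hch : ∀ Bk : Block c, ∃ τ : G × G × G, ρ ≤ bpot c T₀ Bk.out →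
      bpot c T₀ Bk.out = ddist (rt c τ.1 T₀) Bk.out ∧
        τ.2.1 ∈ (rt c τ.1 T₀).1 \ Bk.out.1 ∧ τ.2.2 ∈ (rt c τ.1 T₀).1 \ Bk.out.1 ∧ τ.2.1 ≠ τ.2.2 := by
    intro Bk
    by_cases h : ρ ≤ bpot c T₀ Bk.out
    · obtain ⟨Q, t, t', h1, h3, h4, h5⟩ := exists_choice c T₀ Bk.out (le_trans hρ h)
      exact ⟨(Q, t, t'), fun _ => ⟨h1, h3, h4, h5⟩⟩
    · exact ⟨(1, 1, 1), fun h' => absurd h' h⟩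
  choose τ hτ using hch
  set NI : Finset (Block c) := univ.filter fun Bk : Block c => ρ ≤ bpot c T₀ Bk.out with hNI
  set face : Block c → (CMF G c →₀ ℤ) := fun Bk => gface c hc2 Bk.out (τ Bk).2.1 (τ Bk).2.2 with hfaceDef
  set S₂ : Finset (CMF G c →₀ ℤ) := NI.image face with hS₂
  have hself : ∀ Bk ∈ NI, par c (face Bk) Bk = 1 := by
    intro Bk hBk
    obtain ⟨h1, h3, h4, h5⟩ := hτ Bk (mem_filter.mp hBk).2
    have h := par_cover_self c T₀ hc2 h1 h3 h4 h5
    rwa [blk_out] at h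
  have hother : ∀ Bk ∈ NI, ∀ B : Block c, B ≠ Bk → bpot c T₀ Bk.out ≤ bpot c T₀ B.out → par c (face Bk) B = 0 := by
    intro Bk hBk B hB hle
    obtain ⟨h1, h3, h4, h5⟩ := hτ Bk (mem_filter.mp hBk).2
    exact par_cover_other c T₀ hc2 h1 h3 h4 h5 (by rw [blk_out]; exact hB) hle
  have hinj : Set.InjOn face ↑NI := by
    intro B₁ hB₁ B₂ hB₂ heq
    by_contra hne
    rcases le_total (bpot c T₀ B₁.out) (bpot c T₀ B₂.out) with hle | hle
    · have h0 := hother B₁ hB₁ B₂ (Ne.symm hne) hle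
      rw [heq, hself B₂ hB₂] at h0
      exact one_ne_zero h0
    · have h0 := hother B₂ hB₂ B₁ hne hle
      rw [← heq, hself B₁ hB₁] at h0
      exact one_ne_zero h0
  have hSsub : (↑S₂ : Set (CMF G c →₀ ℤ)) ⊆ gfaceSet G c hc2 := by
    intro y hy
    obtain ⟨Bk, hBk, rfl⟩ := mem_image.mp (mem_coe.mp hy)
    obtain ⟨-, h3, h4, h5⟩ := hτ Bk (mem_filter.mp hBk).2
    exact ⟨Bk.out, _, _, not_mem_orb_of_mem (mem_sdiff.mp h3).1 (mem_sdiff.mp h4).1 h5, rfl⟩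
  -- no near member is a far covering face (parity `1` vs `0` at a far block)
  have hnot : ∀ Bk ∈ NI, face Bk ∉ S₁ := by
    intro Bk hBk hmem
    have h0 := hfar₁ _ hmem Bk (mem_filter.mp hBk).2
    rw [hself Bk hBk] at h0
    exact one_ne_zero h0
  have hdisj : Disjoint S₁ S₂ := by
    rw [Finset.disjoint_right]
    intro f hf
    obtain ⟨Bk, hBk, rfl⟩ := mem_image.mp hf
    exact hnot Bk hBk
  refine ⟨S₂, hSsub, card_image_of_injOn hinj, hdisj, ?_, fun L hL Φ hΦ2 => ?_⟩
  · -- JOINT fibre independence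
    set p : (CMF G c →₀ ℤ) → Block c := fun f => if h : ∃ Bk ∈ NI, face Bk = f then h.choose else blk c T₀ with hp
    have hpf : ∀ Bk ∈ NI, p (face Bk) = Bk := by
      intro Bk hBk
      have h : ∃ B ∈ NI, face B = face Bk := ⟨Bk, hBk, rfl⟩
      rw [hp]; simp only [dif_pos h]
      exact hinj h.choose_spec.1 hBk h.choose_spec.2
    rw [linearIndepOn_iff]
    intro l hl hsum
    -- the parity of the vanishing combination
    set Pbar := (rad2 c hc2).liftQ (par2 c) (rad2_le_ker_par2 c hc2) with hPbar
    have hpar : ∑ f ∈ l.support, l f • par c f = 0 := by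
      have h := congrArg Pbar hsum
      rw [map_zero, Finsupp.linearCombination_apply, Finsupp.sum, map_sum] at h
      rw [← h]
      refine Finset.sum_congr rfl fun f _ => ?_
      rw [map_smul, par_eq_liftQ_mkQ c hc2 f]
    have hsupp : ∀ f ∈ l.support, f ∈ S₁ ∨ f ∈ S₂ := fun f hf => by
      have h := (Finsupp.mem_supported _ l).mp hl hf
      rw [coe_union] at h
      rcases h with h | h
      · exact Or.inl h
      · exact Or.inr h
    -- (a) the coefficients of the far faces vanish
    have hfarzero : ∀ f ∈ l.support, f ∈ S₂ → l f = 0 := by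
      by_contra hbad
      push Not at hbad
      obtain ⟨f₁, hf₁, hf₁S, hlf₁⟩ := hbad
      obtain ⟨i₀, hi₀, hmax⟩ := Finset.exists_max_image (l.support.filter fun f => f ∈ S₂ ∧ l f ≠ 0)
        (fun f => bpot c T₀ (p f).out) ⟨f₁, mem_filter.mpr ⟨hf₁, hf₁S, hlf₁⟩⟩
      obtain ⟨hi₀s, hi₀S, hli₀⟩ := mem_filter.mp hi₀
      obtain ⟨B₀, hB₀, hfB₀⟩ := mem_image.mp hi₀S
      have hp₀ : p i₀ = B₀ := by rw [← hfB₀]; exact hpf B₀ hB₀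
      have heval := congrFun hpar B₀
      rw [Finset.sum_apply, Pi.zero_apply, Finset.sum_eq_single_of_mem i₀ hi₀s] at heval
      · rw [Pi.smul_apply, smul_eq_mul, ← hfB₀, hself B₀ hB₀, mul_one] at heval
        exact hli₀ (hfB₀ ▸ heval)
      · intro f hf hfi
        rw [Pi.smul_apply, smul_eq_mul]
        by_cases hlf : l f = 0
        · rw [hlf, zero_mul]
        rcases hsupp f hf with h1 | h2
        · -- near member: vanishes on the far block `B₀`
          rw [hfar₁ f h1 B₀ (mem_filter.mp hB₀).2, mul_zero]
        · obtain ⟨Bf, hBf, hfBf⟩ := mem_image.mp h2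
          have hpj : p f = Bf := by rw [← hfBf]; exact hpf Bf hBf
          have hlj : bpot c T₀ Bf.out ≤ bpot c T₀ B₀.out := by
            have h := hmax f (mem_filter.mpr ⟨hf, h2, hlf⟩)
            rwa [hpj, hp₀] at h
          have hne : B₀ ≠ Bf := fun e => hfi (by rw [← hfBf, ← hfB₀, e])
          rw [← hfBf, hother Bf hBf B₀ hne hlj, mul_zero]
    -- (b) so the combination is supported on `S₁`, where independence holds
    have hl1 : l ∈ Finsupp.supported (ZMod 2) (ZMod 2) (↑S₁ : Set (CMF G c →₀ ℤ)) := by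
      rw [Finsupp.mem_supported]
      intro f hf
      rcases hsupp f hf with h1 | h2
      · exact h1
      · exact absurd (hfarzero f hf h2) (Finsupp.mem_support_iff.mp hf)
    exact (linearIndepOn_iff.mp hli₁) l hl1 hsum
  · -- the `toward` property through every far type (as in part K)
    obtain ⟨Q, hQ⟩ := exists_rt_eq_of_blk_eq c (Quotient.out_eq (blk c Φ) : blk c (blk c Φ).out = blk c Φ)
    have hBNI : blk c Φ ∈ NI := mem_filter.mpr ⟨mem_univ _, by rw [bpot_out]; exact hΦ2⟩
    obtain ⟨h1, h3, h4, h5⟩ := hτ (blk c Φ) (mem_filter.mp hBNI).2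
    set R := (τ (blk c Φ)).1
    set t := (τ (blk c Φ)).2.1
    set t' := (τ (blk c Φ)).2.2
    have hmem : gface c hc2 Φ (t * Q⁻¹) (t' * Q⁻¹) ∈ L := by
      have e : gface c hc2 Φ (t * Q⁻¹) (t' * Q⁻¹) = Finsupp.mapDomain (rt c Q) (face (blk c Φ)) := by
        rw [mapDomain_rt_gface, hQ]
      rw [e]
      exact hL (Submodule.subset_span ⟨Q, _, mem_image_of_mem _ hBNI, rfl⟩)
    have hQ' : bpot c T₀ Φ = ddist (rt c (Q * R) T₀) Φ := by
      rw [← hQ, bpot_rt, rt_mul, ddist_rt]; exact h1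
    have hs : t * Q⁻¹ ∈ (rt c (Q * R) T₀).1 \ Φ.1 := by
      rw [rt_mul, ← hQ, mem_sdiff_rt_iff, inv_mul_cancel_right]; exact h3
    have hs' : t' * Q⁻¹ ∈ (rt c (Q * R) T₀).1 \ Φ.1 := by
      rw [rt_mul, ← hQ, mem_sdiff_rt_iff, inv_mul_cancel_right]; exact h4
    have hss' : t * Q⁻¹ ≠ t' * Q⁻¹ := fun h => h5 (mul_right_cancel h)
    exact ⟨Q * R, t * Q⁻¹, t' * Q⁻¹, hQ', hs, hs', hss', hmem⟩

/-- **Faces at the base type vanish on far blocks**: a face at `T₀` has corners of potential `≤ 2`, so its block parity vanishes at every block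
of potential `≥ 3` — the hypothesis `hfar₁` of `exists_joint_cover` for `ρ = 3` and near families of faces at `T₀`. [folklore] -/
theorem par_gface_base_eq_zero_of_far (hc2 : c * c = 1) (t t' : G) (B : Block c) (hB : 3 ≤ bpot c T₀ B.out) :
    par c (gface c hc2 T₀ t t') B = 0 := by
  -- all four corners are within distance `2` of `T₀ = T₀·1⁻¹`
  have hle : ∀ Φ : CMF G c, ddist T₀ Φ ≤ 2 → blk c Φ ≠ B := by
    intro Φ hΦ e
    have h1 : bpot c T₀ Φ ≤ 2 := (bpot_le c T₀ Φ 1).trans (by rw [rt_one]; exact hΦ)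
    have h2 := bpot_eq_of_blk_eq c T₀ (e.trans (Quotient.out_eq B).symm)
    omega
  have dstep : ∀ (Ψ : CMF G c) (s : G), ddist T₀ (oflipCM c hc2 s Ψ) ≤ ddist T₀ Ψ + 1 := by
    intro Ψ s
    have h3 := ddist_le_ddist_oflipCM_add_one hc2 T₀ (oflipCM c hc2 s Ψ) s
    rw [oflipCM_oflipCM_self] at h3
    exact h3
  have d0 : ddist T₀ T₀ ≤ 2 := by rw [ddist_self]; omega
  have d1 : ddist T₀ (oflipCM c hc2 t T₀) ≤ 2 := by
    have h := dstep T₀ t; rw [ddist_self] at h; omega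
  have d1' : ddist T₀ (oflipCM c hc2 t' T₀) ≤ 2 := by
    have h := dstep T₀ t'; rw [ddist_self] at h; omega
  have d2 : ddist T₀ (oflipCM c hc2 t (oflipCM c hc2 t' T₀)) ≤ 2 := by
    have h1 := dstep T₀ t'
    have h2 := dstep (oflipCM c hc2 t' T₀) t
    rw [ddist_self] at h1
    omega
  rw [par_gface_apply c hc2 T₀ t t' B, if_neg (hle _ d0), if_neg (hle _ d2), if_neg (hle _ d1), if_neg (hle _ d1')]
  ring

end

end Summit.HodgeConjecture.CorCM.Census.BaseBlock
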